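import Literature.NumberTheory.Sieve.LargestPrimeFactorCubicRootPairs
import Literature.NumberTheory.Sieve.LargestPrimeFactorCubicSetup
import Literature.NumberTheory.Sieve.DivisorBound
import HarnessLib

/-!
# Heath-Brown 2001 (PLMS), §8: the error terms `T·E/m`, `η·W_max` (times `log X`) tend to `0`

Topic `Literature/NumberTheory/Sieve`; a PROVED analytic layer (no definitions, no named facts) under the
named fact `Irving2015_largestPrimeFactor_cubic` (`LargestPrimeFactorCubic.lean`): power-saving estimates for
the error coefficients of `…S0Main.S0sumG_regionGens_ge`.  Source: D. R. Heath-Brown, *The largest prime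
factor of `X³ + 2`*, Proc. London Math. Soc. (3) 82 (2001) 554–596, §6 p. 22 ("an error term
`O(X^{3δ}M^ε)` … (6.2) … which is satisfactory"), §8 p. 30 (the relative error `O(X^{−δ/6})`), with the
divisor-type bounds `τ(n), 3^{ω(n)}, ρ(d) ≪ n^ε`.

* `card_kPrimes_le` (`#𝒦 ≤ X^{4δ}`), `sum_rootsCube_range_le` (`∑_{d<⌈X^{3δ}⌉} ρ(d) ≤ 2Cr X^{3δ}(2X^{3δ})^{ε}` for `X^{3δ} ≥ 1`),
  `Ebound_le` (`E_X ≤ 12 Cr 2^ε X^{7δ+3δε}`);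
* `tendsto_pow_mul_log_div_pow` (`X^a log X / X^b → 0` for `a < b`);
* **`tendsto_TE_div_m`** — `T_X E_X log X / m_X → 0` for `m_X ≥ X^{(1+δ)/3}/2`, `T_X = Cd²(375X^{1+2δ})^{2ε₀}`, `ε₀ ≤ δ`;
* **`tendsto_eta_Wmax`** — `η_X W_X log X → 0` for `η_X ≤ 6000X^{−δ/6}`, `W_X = Cd²(X^{1+2δ})^{2ε₀}`, `26ε₀ ≤ δ`.

## References

* D. R. Heath-Brown, *The largest prime factor of `X³ + 2`*, Proc. London Math. Soc. (3) 82 (2001)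
  554–596, §6 p. 22, §8 p. 30. [`HeathBrown2001LargestPrimeFactorCubic`]

## Mathlib / tree search

Tree: `kPrimes`, `hbδ`, `hbδ_pos` (`…Setup`), `rootsCube`, `exists_card_rootsCube_le_rpow` (`…RootPairs`).
Mathlib: `tendsto_rpow_neg_atTop`, `Real.isLittleO_log_rpow_atTop`-free (we use `Real.log_le_rpow_div`),
`Nat.card_Ioc`, `Nat.floor_le`, `Nat.ceil_lt_add_one`.
-/

noncomputable section

open Finset Real Filter Topology

namespace Literature.NumberTheory.Sieve.HeathBrown2001

open LargestPrimeFactorCubic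

/-- `#𝒦 ≤ X^{4δ}`. [folklore] -/
theorem card_kPrimes_le (X : ℕ) : (#(kPrimes X) : ℝ) ≤ (X : ℝ) ^ (4 * hbδ) := by
  have h1 : #(kPrimes X) ≤ ⌊(X : ℝ) ^ (4 * hbδ)⌋₊ := by
    calc #(kPrimes X) ≤ #(Ioc ⌊(X : ℝ) ^ (3 * hbδ)⌋₊ ⌊(X : ℝ) ^ (4 * hbδ)⌋₊) := card_le_card (filter_subset _ _)
      _ = ⌊(X : ℝ) ^ (4 * hbδ)⌋₊ - ⌊(X : ℝ) ^ (3 * hbδ)⌋₊ := Nat.card_Ioc _ _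
      _ ≤ ⌊(X : ℝ) ^ (4 * hbδ)⌋₊ := Nat.sub_le _ _
  calc (#(kPrimes X) : ℝ) ≤ ⌊(X : ℝ) ^ (4 * hbδ)⌋₊ := by exact_mod_cast h1
    _ ≤ (X : ℝ) ^ (4 * hbδ) := Nat.floor_le (by positivity)

/-- `∑_{d < ⌈Y⌉} ρ(d) ≤ (Y+1)·Cr·(Y+1)^{ε}` for `Y ≥ 0`, with `#rootsCube d ≤ Cr d^ε`. [folklore] -/
theorem sum_rootsCube_range_le {Cr ε Y : ℝ} (hCr : 0 ≤ Cr) (hε : 0 ≤ ε) (hY : 0 ≤ Y)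
    (hroot : ∀ q : ℕ, q ≠ 0 → (#(rootsCube q) : ℝ) ≤ Cr * (q : ℝ) ^ ε) :
    ∑ d ∈ Finset.range ⌈Y⌉₊, (#(rootsCube d) : ℝ) ≤ (Y + 1) * (Cr * (Y + 1) ^ ε) := by
  have hD : (⌈Y⌉₊ : ℝ) ≤ Y + 1 := (Nat.ceil_lt_add_one hY).le
  have hterm : ∀ d ∈ Finset.range ⌈Y⌉₊, (#(rootsCube d) : ℝ) ≤ Cr * (Y + 1) ^ ε := by
    intro d hd
    rw [Finset.mem_range] at hd
    rcases Nat.eq_zero_or_pos d with rfl | hd0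
    · have : rootsCube 0 = ∅ := by unfold rootsCube; simp
      rw [this]; simp; positivity
    · refine (hroot d hd0.ne').trans (mul_le_mul_of_nonneg_left ?_ hCr)
      refine Real.rpow_le_rpow (Nat.cast_nonneg _) ?_ hε
      have : (d : ℝ) ≤ ⌈Y⌉₊ := by exact_mod_cast hd.le
      linarith
  calc ∑ d ∈ Finset.range ⌈Y⌉₊, (#(rootsCube d) : ℝ) ≤ ∑ _d ∈ Finset.range ⌈Y⌉₊, Cr * (Y + 1) ^ ε := sum_le_sum hterm
    _ = ⌈Y⌉₊ * (Cr * (Y + 1) ^ ε) := by rw [sum_const, card_range, nsmul_eq_mul]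
    _ ≤ (Y + 1) * (Cr * (Y + 1) ^ ε) := mul_le_mul_of_nonneg_right hD (by positivity)

/-- **`E_X = 3#𝒦∑_{d<⌈X^{3δ}⌉}ρ(d) ≤ 3X^{4δ}(X^{3δ}+1)Cr(X^{3δ}+1)^ε`**. [cite: HeathBrown2001LargestPrimeFactorCubic, §6 (6.2)] -/
theorem Ebound_le {Cr ε : ℝ} (hCr : 0 ≤ Cr) (hε : 0 ≤ ε)
    (hroot : ∀ q : ℕ, q ≠ 0 → (#(rootsCube q) : ℝ) ≤ Cr * (q : ℝ) ^ ε) (X : ℕ) :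
    3 * #(kPrimes X) * ∑ d ∈ Finset.range ⌈(X : ℝ) ^ (3 * hbδ)⌉₊, (#(rootsCube d) : ℝ) ≤
      3 * (X : ℝ) ^ (4 * hbδ) * (((X : ℝ) ^ (3 * hbδ) + 1) * (Cr * ((X : ℝ) ^ (3 * hbδ) + 1) ^ ε)) := by
  have h1 := card_kPrimes_le X
  have h2 := sum_rootsCube_range_le hCr hε (by positivity : (0 : ℝ) ≤ (X : ℝ) ^ (3 * hbδ)) hroot
  have h0 : 0 ≤ ∑ d ∈ Finset.range ⌈(X : ℝ) ^ (3 * hbδ)⌉₊, (#(rootsCube d) : ℝ) := sum_nonneg fun _ _ => Nat.cast_nonneg _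
  calc 3 * #(kPrimes X) * ∑ d ∈ Finset.range ⌈(X : ℝ) ^ (3 * hbδ)⌉₊, (#(rootsCube d) : ℝ)
      ≤ 3 * (X : ℝ) ^ (4 * hbδ) * ∑ d ∈ Finset.range ⌈(X : ℝ) ^ (3 * hbδ)⌉₊, (#(rootsCube d) : ℝ) := by gcongr
    _ ≤ _ := mul_le_mul_of_nonneg_left h2 (by positivity)

/-- `X^a · log X / X^b → 0` for `a < b` (along `ℕ`). [folklore] -/
theorem tendsto_pow_mul_log_div_pow {a b : ℝ} (hab : a < b) :
    Tendsto (fun X : ℕ => (X : ℝ) ^ a * Real.log X / (X : ℝ) ^ b) atTop (𝓝 0) := by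
  -- `log X ≤ X^{c}/c` with `c = (b-a)/2`, so the quotient is `≤ X^{-(b-a)/2}/c`
  set c := (b - a) / 2 with hc
  have hc0 : 0 < c := by rw [hc]; linarith
  have hlim : Tendsto (fun X : ℕ => (X : ℝ) ^ (-c) / c) atTop (𝓝 0) := by
    have := ((tendsto_rpow_neg_atTop hc0).comp tendsto_natCast_atTop_atTop).div_const c
    rw [zero_div] at this
    exact this
  refine squeeze_zero' ?_ ?_ hlim
  · filter_upwards [eventually_ge_atTop 1] with X hX
    have hX1 : (1 : ℝ) ≤ X := by exact_mod_cast hX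
    exact div_nonneg (mul_nonneg (by positivity) (Real.log_nonneg hX1)) (by positivity)
  · filter_upwards [eventually_ge_atTop 1] with X hX
    have hX0 : (0 : ℝ) < X := by exact_mod_cast hX
    have hlog : Real.log X ≤ (X : ℝ) ^ c / c := Real.log_le_rpow_div hX0.le hc0
    calc (X : ℝ) ^ a * Real.log X / (X : ℝ) ^ b ≤ (X : ℝ) ^ a * ((X : ℝ) ^ c / c) / (X : ℝ) ^ b := by
          gcongr
      _ = (X : ℝ) ^ (-c) / c := by
          rw [Real.rpow_neg hX0.le, show b = a + c + c by rw [hc]; ring, Real.rpow_add hX0, Real.rpow_add hX0]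
          field_simp

/-- **`T_X E_X log X / m_X → 0`** when `m_X ≥ X^{(1+δ)/3}/2`, `T_X = Cd²(375X^{1+2δ})^{2ε₀}`, `0 < ε₀ ≤ δ`,
`ρ(d) ≤ Cr d^{ε₀}`. [cite: HeathBrown2001LargestPrimeFactorCubic, §6 (6.2), §8] -/
theorem tendsto_TE_div_m {Cd Cr ε₀ : ℝ} (hCr : 0 ≤ Cr) (hε₀ : 0 < ε₀) (hε₀δ : ε₀ ≤ hbδ)
    (hroot : ∀ q : ℕ, q ≠ 0 → (#(rootsCube q) : ℝ) ≤ Cr * (q : ℝ) ^ ε₀) {m : ℕ → ℕ}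
    (hm : ∀ᶠ X : ℕ in atTop, (X : ℝ) ^ ((1 + hbδ) / 3) / 2 ≤ (m X : ℝ)) :
    Tendsto (fun X : ℕ => (Cd ^ 2 * (375 * (X : ℝ) ^ (1 + 2 * hbδ)) ^ (2 * ε₀)) *
      (3 * #(kPrimes X) * ∑ d ∈ Finset.range ⌈(X : ℝ) ^ (3 * hbδ)⌉₊, (#(rootsCube d) : ℝ)) * Real.log X / (m X : ℝ))
      atTop (𝓝 0) := by
  have hδ := hbδ_pos
  have hδ1 : hbδ < 1 / 100 := by rw [hbδ]; norm_num
  -- dominate by `K · X^{a} log X / X^{(1+δ)/3}` with `a = 2(1+2δ)ε₀ + 4δ + (3δ)(1+ε₀) + tiny`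
  set a : ℝ := 2 * (1 + 2 * hbδ) * ε₀ + 4 * hbδ + 3 * hbδ * (1 + ε₀) with ha
  have hab : a < (1 + hbδ) / 3 := by
    rw [ha]
    have : ε₀ ≤ 1 / 100 := by linarith
    nlinarith
  set K : ℝ := Cd ^ 2 * (375 : ℝ) ^ (2 * ε₀) * (3 * (2 * (Cr * (2 : ℝ) ^ ε₀))) * 2 with hK
  have hK0 : 0 ≤ K := by rw [hK]; positivity
  have hlim := (tendsto_pow_mul_log_div_pow hab).const_mul K
  rw [mul_zero] at hlim
  refine squeeze_zero' ?_ ?_ hlim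
  · filter_upwards [eventually_ge_atTop 1] with X hX
    have hX1 : (1 : ℝ) ≤ X := by exact_mod_cast hX
    refine div_nonneg (mul_nonneg (mul_nonneg (by positivity) ?_) (Real.log_nonneg hX1)) (Nat.cast_nonneg _)
    exact mul_nonneg (by positivity) (sum_nonneg fun _ _ => Nat.cast_nonneg _)
  · filter_upwards [eventually_ge_atTop 1, hm] with X hX hmX
    have hX0 : (0 : ℝ) < X := by exact_mod_cast hX
    have hX1 : (1 : ℝ) ≤ X := by exact_mod_cast hX
    have hmpos : (0 : ℝ) < m X := lt_of_lt_of_le (by positivity) hmX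
    have hlog0 : 0 ≤ Real.log X := Real.log_nonneg hX1
    -- bound `T`
    have hT : Cd ^ 2 * (375 * (X : ℝ) ^ (1 + 2 * hbδ)) ^ (2 * ε₀) = Cd ^ 2 * (375 : ℝ) ^ (2 * ε₀) * (X : ℝ) ^ (2 * (1 + 2 * hbδ) * ε₀) := by
      rw [Real.mul_rpow (by norm_num) (by positivity), ← Real.rpow_mul hX0.le]; ring_nf
    -- bound `E`
    have hE := Ebound_le hCr hε₀.le hroot X
    have hX3 : (1 : ℝ) ≤ (X : ℝ) ^ (3 * hbδ) := Real.one_le_rpow hX1 (by positivity)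
    have hE' : 3 * (X : ℝ) ^ (4 * hbδ) * (((X : ℝ) ^ (3 * hbδ) + 1) * (Cr * ((X : ℝ) ^ (3 * hbδ) + 1) ^ ε₀)) ≤
        3 * (2 * (Cr * (2 : ℝ) ^ ε₀)) * ((X : ℝ) ^ (4 * hbδ) * (X : ℝ) ^ (3 * hbδ * (1 + ε₀))) := by
      have h1 : (X : ℝ) ^ (3 * hbδ) + 1 ≤ 2 * (X : ℝ) ^ (3 * hbδ) := by linarith
      have h2 : ((X : ℝ) ^ (3 * hbδ) + 1) ^ ε₀ ≤ (2 * (X : ℝ) ^ (3 * hbδ)) ^ ε₀ :=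
        Real.rpow_le_rpow (by positivity) h1 hε₀.le
      rw [Real.mul_rpow (by norm_num) (by positivity), ← Real.rpow_mul hX0.le] at h2
      have h3 : (X : ℝ) ^ (3 * hbδ * (1 + ε₀)) = (X : ℝ) ^ (3 * hbδ) * (X : ℝ) ^ (3 * hbδ * ε₀) := by
        rw [← Real.rpow_add hX0]; ring_nf
      rw [h3]
      have hx4 : 0 ≤ (X : ℝ) ^ (4 * hbδ) := by positivity
      have hx3 : 0 ≤ (X : ℝ) ^ (3 * hbδ) := by positivity
      have hx3e : 0 ≤ (X : ℝ) ^ (3 * hbδ * ε₀) := by positivity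
      calc 3 * (X : ℝ) ^ (4 * hbδ) * (((X : ℝ) ^ (3 * hbδ) + 1) * (Cr * ((X : ℝ) ^ (3 * hbδ) + 1) ^ ε₀))
          ≤ 3 * (X : ℝ) ^ (4 * hbδ) * ((2 * (X : ℝ) ^ (3 * hbδ)) * (Cr * ((2 : ℝ) ^ ε₀ * (X : ℝ) ^ (3 * hbδ * ε₀)))) := by
            gcongr
        _ = 3 * (2 * (Cr * (2 : ℝ) ^ ε₀)) * ((X : ℝ) ^ (4 * hbδ) * ((X : ℝ) ^ (3 * hbδ) * (X : ℝ) ^ (3 * hbδ * ε₀))) := by ring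
    have hEfin : 3 * #(kPrimes X) * ∑ d ∈ Finset.range ⌈(X : ℝ) ^ (3 * hbδ)⌉₊, (#(rootsCube d) : ℝ) ≤
        3 * (2 * (Cr * (2 : ℝ) ^ ε₀)) * (X : ℝ) ^ (4 * hbδ + 3 * hbδ * (1 + ε₀)) := by
      rw [Real.rpow_add hX0]; exact hE.trans hE'
    have hE0 : 0 ≤ 3 * #(kPrimes X) * ∑ d ∈ Finset.range ⌈(X : ℝ) ^ (3 * hbδ)⌉₊, (#(rootsCube d) : ℝ) :=
      mul_nonneg (by positivity) (sum_nonneg fun _ _ => Nat.cast_nonneg _)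
    -- combine
    rw [hT]
    calc Cd ^ 2 * (375 : ℝ) ^ (2 * ε₀) * (X : ℝ) ^ (2 * (1 + 2 * hbδ) * ε₀) *
          (3 * #(kPrimes X) * ∑ d ∈ Finset.range ⌈(X : ℝ) ^ (3 * hbδ)⌉₊, (#(rootsCube d) : ℝ)) * Real.log X / (m X : ℝ)
        ≤ Cd ^ 2 * (375 : ℝ) ^ (2 * ε₀) * (X : ℝ) ^ (2 * (1 + 2 * hbδ) * ε₀) *
            (3 * (2 * (Cr * (2 : ℝ) ^ ε₀)) * (X : ℝ) ^ (4 * hbδ + 3 * hbδ * (1 + ε₀))) * Real.log X /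
            ((X : ℝ) ^ ((1 + hbδ) / 3) / 2) := by
          gcongr
      _ = K * ((X : ℝ) ^ a * Real.log X / (X : ℝ) ^ ((1 + hbδ) / 3)) := by
          rw [hK, ha, show 2 * (1 + 2 * hbδ) * ε₀ + 4 * hbδ + 3 * hbδ * (1 + ε₀) =
            2 * (1 + 2 * hbδ) * ε₀ + (4 * hbδ + 3 * hbδ * (1 + ε₀)) by ring, Real.rpow_add hX0 _ (4 * hbδ + _)]
          field_simp

/-- **`η_X W_X log X → 0`** when `0 ≤ η_X ≤ 6000X^{−δ/6}`, `W_X = Cd²(X^{1+2δ})^{2ε₀}`, `0 < ε₀`, `26ε₀ ≤ δ`.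
[cite: HeathBrown2001LargestPrimeFactorCubic, §8 p. 30] -/
theorem tendsto_eta_Wmax {Cd ε₀ : ℝ} (hε₀ : 0 < ε₀) (hε₀δ : 26 * ε₀ ≤ hbδ) {η : ℕ → ℝ}
    (hη0 : ∀ X, 0 ≤ η X) (hη : ∀ᶠ X : ℕ in atTop, η X ≤ 6000 * (X : ℝ) ^ (-(hbδ / 6))) :
    Tendsto (fun X : ℕ => η X * (Cd ^ 2 * ((X : ℝ) ^ (1 + 2 * hbδ)) ^ (2 * ε₀)) * Real.log X) atTop (𝓝 0) := by
  have hδ := hbδ_pos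
  have hδ1 : hbδ < 1 / 100 := by rw [hbδ]; norm_num
  set a : ℝ := 2 * (1 + 2 * hbδ) * ε₀ with ha
  have hab : a < hbδ / 6 := by rw [ha]; nlinarith
  have hlim := (tendsto_pow_mul_log_div_pow hab).const_mul (6000 * Cd ^ 2)
  rw [mul_zero] at hlim
  refine squeeze_zero' ?_ ?_ hlim
  · filter_upwards [eventually_ge_atTop 1] with X hX
    have hX1 : (1 : ℝ) ≤ X := by exact_mod_cast hX
    exact mul_nonneg (mul_nonneg (hη0 X) (by positivity)) (Real.log_nonneg hX1)
  · filter_upwards [eventually_ge_atTop 1, hη] with X hX hηX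
    have hX0 : (0 : ℝ) < X := by exact_mod_cast hX
    have hX1 : (1 : ℝ) ≤ X := by exact_mod_cast hX
    have hlog0 : 0 ≤ Real.log X := Real.log_nonneg hX1
    have hW : ((X : ℝ) ^ (1 + 2 * hbδ)) ^ (2 * ε₀) = (X : ℝ) ^ a := by rw [← Real.rpow_mul hX0.le, ha]; ring_nf
    rw [hW]
    calc η X * (Cd ^ 2 * (X : ℝ) ^ a) * Real.log X ≤ (6000 * (X : ℝ) ^ (-(hbδ / 6))) * (Cd ^ 2 * (X : ℝ) ^ a) * Real.log X := by
          gcongr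
      _ = 6000 * Cd ^ 2 * ((X : ℝ) ^ a * Real.log X / (X : ℝ) ^ (hbδ / 6)) := by
          rw [Real.rpow_neg hX0.le]; field_simp

end Literature.NumberTheory.Sieve.HeathBrown2001
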